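/-
Copyright (c) 2026 the pub-hodgecm-mathlib formalisation cell (harness21).  Prover seat hodgecm-mathlib-K2E1-p09 (g3), Track B ∕ K2-LIT,
h413 = `stmt-HodgeConjecture-24833`, line `K2_E1_TraceFormulaBeta`, campaign RES-RANK-ONE, brick (H2), file F3a: the CUSPIDALITY CRITERION — a continuous function
orthogonal to all pseudo-Eisenstein series along `N` has vanishing constant term along `N` (generic coset-space form).  2026-09-04.
-/
import Summits.HodgeConjecture.HodgeConjecture.Theorems.K2E1PseudoEisensteinCuspOrthogonal   -- ★ F2b (F2a, F1 transitively): adjunction, `measurable_tsum_enorm`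
import Mathlib.MeasureTheory.Function.AEEqOfIntegral
import Mathlib.Analysis.Normed.Group.Bounded
import HarnessLib

/-!
# h413 ∕ Track B «K2-LIT», campaign RES-RANK-ONE, brick (H2) file F3a — helper `K2E1PseudoEisensteinCuspidalCriterion`:
# `ψ` continuous and `⟨θ_Φ, ψ⟩ = 0` for all pseudo-Eisenstein series `θ_Φ` along `N` ⟹ the constant term of `ψ` along `N` vanishes identically

Cell `pub/hodgecm-mathlib`, crux H413 = `stmt-HodgeConjecture-24833`, route `HCCMUnconditional`; chair K2-lead (g0), dealer K2E1-plan (g2), DEAL (H2) ∕ ruling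
02:21:21Z («F3 for CONTINUOUS ψ»).  THEOREMS ONLY (no `def`, no `instance`, no `notation`, no named-fact hypothesis, no `sorry`); lane
`--kind proof --supports stmt-HodgeConjecture-24833 --as helper` (count-neutral).

Setting of ★ F1∕F2 (`G` locally compact second countable Hausdorff, `Γ ≤ G` discrete, `N ≤ G` closed with an inversion-invariant Haar measure `ν_N`, `μ` invariant on
`G ⧸ Γ`, `μ_N` invariant on `G ⧸ N`) plus the CO-COMPACTNESS of `Γ ∩ N` in `N` in the tree's currency (★ `exists_isCompact_rational_smul_mem_of_eq_three`):
`∃ C ⊆ N` compact with `∀ u, ∃ δ ∈ Γ ∩ N, δ u ∈ C`.  For CONTINUOUS `ψ : G ⧸ Γ → ℂ` and the constant term `CT_𝓕 ψ(g) = ∫_𝓕 ψ((g u⁻¹)Γ) dν_N(u)` (the ★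
`ConstantTermVanishes` integrand; `𝓕` any measurable fundamental domain of `Γ ∩ N`):
* §1 `measure_le_of_isFundamentalDomain` (`ν_N(𝓕) ≤ ν_N(C) < ∞`), `exists_bound_norm_apply_mk` (`ψ((g u⁻¹)Γ)` is bounded for `g` in a compact set, uniformly in
  `u ∈ N`: `u = δ⁻¹ c`), `integrableOn_constantTerm`, **`continuous_constantTerm`** (dominated convergence, Mathlib `continuousAt_of_dominated`), and the
  right-`N`-invariances `setLIntegral_constantTerm_mul_coe_eq` ∕ `setIntegral_constantTerm_mul_coe_eq` (`CT_𝓕 ψ(g n) = CT_𝓕 ψ(g)`, through the weight form of ★ F1∕F2a);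
* §2 **`setIntegral_constantTerm_eq_zero_of_forall_pseudoEisenstein`** — if `∫_{G⧸Γ} θ_Φ · conj ψ dμ = 0` for every Borel right-`N`-invariant `Φ : G → ℂ` on the honest
  pairing domain `∫⁻ θ_{‖Φ‖}‖ψ‖ dμ < ∞`, and `μ_N` is positive on non-empty open sets, then `CT_𝓕 ψ(g) = 0` for EVERY `g` and every `𝓕`.  Proof: test `Φ = 𝟙_S ∘ π_N`
  for Borel `S ⊆ π_N(K₀)`, `K₀` compact (finiteness by ★ F1 and §1); the adjunction ★ F2a gives `∫_S CT(conj ψ)‾ dμ_N = 0`, so the CONTINUOUS `N`-invariant function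
  `CT_𝓕(conj ψ)` vanishes `μ_N`-a.e. (Mathlib `Integrable.ae_eq_zero_of_forall_setIntegral_eq_zero`), hence everywhere (`μ_N` charges open sets); conjugate.

WHAT IS NOT HERE.  The adelic reading «⟹ ★ `ConstantTermVanishes 𝔓 ψ i`, hence `ψ ∈ cuspForms` when all `i` are covered» with the quantification over all Haar
measures and Borel structures of ★ `ConstantTermVanishes` (F3b `K2E1PseudoEisensteinCuspidalCriterionAdelic`); the density statement for arbitrary `ψ ∈ L²`
(`(L²_cusp)ᗮ = closure span θ_Φ`, (H2)-d, re-dealt).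

HONEST LABEL.  Count-neutral helper; proves no printed statement; HC_CM is proved only modulo the 7 printed citations (2 remaining named inputs: hLiu418 =
`stmt-HodgeConjecture-24832`, h413 = `stmt-HodgeConjecture-24833`) until rung 0 closes.

## References
* [MoeglinWaldspurger1995] C. Mœglin, J.-L. Waldspurger, *Spectral decomposition and Eisenstein series* (1995), II.1.1–II.1.3 (`ψ ⊥ θ_φ ∀φ ⟺ ψ_P = 0`), I.2.6.
* [Garrett2018] P. Garrett, *Modern Analysis of Automorphic Forms by Example*, vol. 1 (2018), §1.8.
* [BorelJacquet1979] A. Borel, H. Jacquet, *Automorphic forms and automorphic representations*, PSPM 33.1 (1979), §4.4.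
-/

set_option autoImplicit false
set_option linter.dupNamespace false  -- the mandated namespace repeats the summit's segment (`HodgeConjecture.HodgeConjecture`)

noncomputable section

open MeasureTheory Measure Set Filter Topology
open Literature.MeasureTheory.Group Literature.NumberTheory.Automorphic
open Summit.HodgeConjecture.HodgeConjecture.Cruxes.H413.K2E1PseudoEisensteinUnfolding
open Summit.HodgeConjecture.HodgeConjecture.Cruxes.H413.K2E1PseudoEisensteinAdjunction
open Summit.HodgeConjecture.HodgeConjecture.Cruxes.H413.K2E1PseudoEisensteinCuspOrthogonal
open scoped ENNReal NNReal Pointwise ComplexConjugate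

namespace Summit.HodgeConjecture.HodgeConjecture.Cruxes.H413.K2E1PseudoEisensteinCuspidalCriterion

/-! ## §1 Co-compact `Γ ∩ N`: finite fundamental domains, bounded integrands, continuity and `N`-invariance of the constant term -/

section Cocompact

variable {G : Type*} [Group G] [TopologicalSpace G] [IsTopologicalGroup G] [SecondCountableTopology G] [T2Space G]
  [MeasurableSpace G] [BorelSpace G] (Γ N : Subgroup G) [DiscreteTopology Γ]
  (νN : Measure N) [νN.IsMulLeftInvariant]

omit [T2Space G] in
/-- **A fundamental domain of a co-compact `Γ ∩ N` has measure at most `ν_N(C)`**: `𝓕 ⊆ ⋃_δ δ⁻¹C`, and `Σ_δ ν_N(𝓕 ∩ δ⁻¹C) = Σ_δ ν_N(δ𝓕 ∩ C) = ν_N(C)` by invariance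
and the tiling `N = ⊔_δ δ𝓕` (Mathlib `IsFundamentalDomain.measure_eq_tsum'`). [folklore] -/
theorem measure_le_of_isFundamentalDomain {C 𝓕 : Set N} (hcov : ∀ u : N, ∃ δ : Γ.subgroupOf N, δ • u ∈ C)
    (h𝓕 : IsFundamentalDomain (Γ.subgroupOf N) 𝓕 νN) : νN 𝓕 ≤ νN C := by
  haveI : Countable (Γ.subgroupOf N) :=
    Function.Injective.countable (f := fun δ : Γ.subgroupOf N => (⟨((δ : N) : G), δ.2⟩ : Γ))
      fun a b h => Subtype.ext (Subtype.ext (congrArg (fun z : Γ => (z : G)) h))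
  haveI : MeasurableConstSMul (Γ.subgroupOf N) N := ⟨fun δ => measurable_const_mul (δ : N)⟩
  have hcover : 𝓕 ⊆ ⋃ δ : Γ.subgroupOf N, 𝓕 ∩ δ⁻¹ • C := fun u hu => by
    obtain ⟨δ, hδ⟩ := hcov u
    exact Set.mem_iUnion.2 ⟨δ, hu, Set.mem_inv_smul_set_iff.2 hδ⟩
  calc νN 𝓕 ≤ νN (⋃ δ : Γ.subgroupOf N, 𝓕 ∩ δ⁻¹ • C) := measure_mono hcover
    _ ≤ ∑' δ : Γ.subgroupOf N, νN (𝓕 ∩ δ⁻¹ • C) := measure_iUnion_le _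
    _ = ∑' δ : Γ.subgroupOf N, νN (C ∩ δ • 𝓕) := by
        refine tsum_congr fun δ => ?_
        have h1 : δ • (𝓕 ∩ δ⁻¹ • C) = δ • 𝓕 ∩ C := by
          rw [Set.smul_set_inter, smul_inv_smul]
        rw [← measure_smul νN δ (𝓕 ∩ δ⁻¹ • C), h1, Set.inter_comm]
    _ = νN C := (h𝓕.measure_eq_tsum' C).symm

omit [SecondCountableTopology G] [T2Space G] [MeasurableSpace G] [BorelSpace G] [DiscreteTopology Γ] in
/-- **Uniform boundedness of the constant-term integrand**: for `ψ` continuous on `G ⧸ Γ`, `K₀ ⊆ G` compact and `Γ ∩ N` co-compact in `N` (`N = (Γ∩N)·C`),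
`‖ψ((g u⁻¹)Γ)‖ ≤ M` for all `g ∈ K₀`, `u ∈ N` (write `u = δ⁻¹ c`, `c ∈ C`: `(g u⁻¹)Γ = (g c⁻¹ δ)Γ = (g c⁻¹)Γ`, and `K₀ × C` is compact). [folklore] -/
theorem exists_bound_norm_apply_mk {ψ : G ⧸ Γ → ℂ} (hψ : Continuous ψ) {C : Set N} (hC : IsCompact C)
    (hcov : ∀ u : N, ∃ δ : Γ.subgroupOf N, δ • u ∈ C) {K₀ : Set G} (hK₀ : IsCompact K₀) :
    ∃ M : ℝ, 0 ≤ M ∧ ∀ g ∈ K₀, ∀ u : N, ‖ψ (QuotientGroup.mk (g * (u : G)⁻¹))‖ ≤ M := by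
  have hcont : Continuous fun p : G × N => ψ (QuotientGroup.mk (p.1 * (p.2 : G)⁻¹)) :=
    hψ.comp (QuotientGroup.continuous_mk.comp (continuous_fst.mul (continuous_subtype_val.comp continuous_snd).inv))
  obtain ⟨M, hM⟩ := (hK₀.prod hC).exists_bound_of_continuousOn hcont.continuousOn
  refine ⟨max M 0, le_max_right _ _, fun g hg u => ?_⟩
  obtain ⟨δ, hδ⟩ := hcov u
  have hu : (u : G)⁻¹ = ((δ • u : N) : G)⁻¹ * ((⟨((δ : N) : G), δ.2⟩ : Γ) : G) := by
    rw [Subgroup.smul_def, smul_eq_mul, Subgroup.coe_mul, mul_inv_rev, inv_mul_cancel_right]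
  rw [hu, ← mul_assoc, QuotientGroup.mk_mul_of_mem _ (⟨((δ : N) : G), δ.2⟩ : Γ).2]
  exact (hM (g, δ • u) ⟨hg, hδ⟩).trans (le_max_left _ _)

omit [T2Space G] in
/-- The constant-term integrand `u ↦ ψ((g u⁻¹)Γ)` is integrable on every fundamental domain `𝓕` of a co-compact `Γ ∩ N` (bounded, `ν_N(𝓕) < ∞`). [folklore] -/
theorem integrableOn_constantTerm {ψ : G ⧸ Γ → ℂ} (hψ : Continuous ψ) {C : Set N} (hC : IsCompact C)
    (hcov : ∀ u : N, ∃ δ : Γ.subgroupOf N, δ • u ∈ C) {𝓕 : Set N} (h𝓕 : IsFundamentalDomain (Γ.subgroupOf N) 𝓕 νN) [IsFiniteMeasureOnCompacts νN] (g : G) :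
    IntegrableOn (fun u : N => ψ (QuotientGroup.mk (g * (u : G)⁻¹))) 𝓕 νN := by
  obtain ⟨M, -, hM⟩ := exists_bound_norm_apply_mk Γ N hψ hC hcov isCompact_singleton
  have hfin : νN 𝓕 ≠ ∞ := ((measure_le_of_isFundamentalDomain Γ N νN hcov h𝓕).trans_lt hC.measure_lt_top).ne
  refine Measure.integrableOn_of_bounded hfin ?_ (M := M) (Eventually.of_forall fun u => hM g rfl u)
  exact (hψ.comp (QuotientGroup.continuous_mk.comp (continuous_const.mul continuous_subtype_val.inv))).aestronglyMeasurable

/-- **CONTINUITY OF THE CONSTANT TERM** `g ↦ ∫_𝓕 ψ((g u⁻¹)Γ) dν_N(u)` for continuous `ψ` and co-compact `Γ ∩ N` (dominated convergence on `𝓕` with a constant bound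
valid on a compact neighbourhood of each point). [cite: MoeglinWaldspurger1995, I.2.6] -/
theorem continuous_constantTerm [LocallyCompactSpace G] {ψ : G ⧸ Γ → ℂ} (hψ : Continuous ψ) {C : Set N} (hC : IsCompact C)
    (hcov : ∀ u : N, ∃ δ : Γ.subgroupOf N, δ • u ∈ C) {𝓕 : Set N} (h𝓕 : IsFundamentalDomain (Γ.subgroupOf N) 𝓕 νN) [IsFiniteMeasureOnCompacts νN] :
    Continuous fun g : G => ∫ u in 𝓕, ψ (QuotientGroup.mk (g * (u : G)⁻¹)) ∂νN := by
  have hfin : νN 𝓕 < ∞ := (measure_le_of_isFundamentalDomain Γ N νN hcov h𝓕).trans_lt hC.measure_lt_top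
  refine continuous_iff_continuousAt.2 fun g₀ => ?_
  obtain ⟨K₀, hK₀, hK₀g⟩ := exists_compact_mem_nhds g₀
  obtain ⟨M, -, hM⟩ := exists_bound_norm_apply_mk Γ N hψ hC hcov hK₀
  have hmeas : ∀ g : G, AEStronglyMeasurable (fun u : N => ψ (QuotientGroup.mk (g * (u : G)⁻¹))) (νN.restrict 𝓕) := fun g =>
    (hψ.comp (QuotientGroup.continuous_mk.comp (continuous_const.mul continuous_subtype_val.inv))).aestronglyMeasurable
  refine continuousAt_of_dominated (bound := fun _ => M) (Eventually.of_forall hmeas) ?_ ?_ ?_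
  · filter_upwards [hK₀g] with g hg
    exact Eventually.of_forall fun u => hM g hg u
  · exact (integrableOn_const_iff (s := 𝓕) (μ := νN) (C := M)).2 (Or.inr hfin)
  · exact Eventually.of_forall fun u =>
      (hψ.comp (QuotientGroup.continuous_mk.comp (continuous_id.mul continuous_const))).continuousAt

end Cocompact

section Invariance

variable {G : Type*} [Group G] [TopologicalSpace G] [IsTopologicalGroup G] [SecondCountableTopology G] [T2Space G]
  [MeasurableSpace G] [BorelSpace G] (Γ N : Subgroup G) [DiscreteTopology Γ] [MeasurableSpace (G ⧸ Γ)] [BorelSpace (G ⧸ Γ)]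
  (νN : Measure N) [νN.IsMulLeftInvariant] [νN.IsInvInvariant]

omit [T2Space G] in
/-- **Right-`N`-invariance of the `[0, ∞]` constant term**: `∫⁻_𝓕 Ψ((g n u⁻¹)Γ) dν_N(u) = ∫⁻_𝓕 Ψ((g u⁻¹)Γ) dν_N(u)` for `n ∈ N` (both sides equal the
manifestly invariant weight form `∫⁻_N Ψ((g m)Γ) β(g m) dν_N(m)` of ★ F1 `lintegral_mul_weight_eq_setLIntegral`). [cite: MoeglinWaldspurger1995, I.2.6] -/
theorem setLIntegral_constantTerm_mul_coe_eq {Ψ : G ⧸ Γ → ℝ≥0∞} (hΨm : Measurable Ψ)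
    {𝓕 : Set N} (h𝓕 : IsFundamentalDomain (Γ.subgroupOf N) 𝓕 νN) (g : G) (n : N) :
    ∫⁻ u in 𝓕, Ψ (QuotientGroup.mk (g * n * (u : G)⁻¹)) ∂νN = ∫⁻ u in 𝓕, Ψ (QuotientGroup.mk (g * (u : G)⁻¹)) ∂νN := by
  obtain ⟨β, hβm, hβ⟩ := exists_weight Γ N
  have hmk : Measurable (QuotientGroup.mk : G → G ⧸ Γ) := QuotientGroup.continuous_mk.measurable
  have hΨ' : ∀ (x : G) (γ : Γ), Ψ (QuotientGroup.mk (x * γ)) = Ψ (QuotientGroup.mk x) := fun x γ => by rw [QuotientGroup.mk_mul_of_mem x γ.2]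
  rw [← lintegral_mul_weight_eq_setLIntegral Γ N νN (Ψ := fun x => Ψ (QuotientGroup.mk x)) (hΨm.comp hmk) hβm hΨ' hβ h𝓕 (g * n),
    ← lintegral_mul_weight_eq_setLIntegral Γ N νN (Ψ := fun x => Ψ (QuotientGroup.mk x)) (hΨm.comp hmk) hβm hΨ' hβ h𝓕 g,
    ← lintegral_mul_left_eq_self (μ := νN) (fun m : N => Ψ (QuotientGroup.mk (g * m)) * β (g * m)) n]
  simp only [Subgroup.coe_mul, mul_assoc]

omit [T2Space G] in
/-- **Right-`N`-invariance of the constant term** (complex values): `∫_𝓕 ψ((g n u⁻¹)Γ) dν_N(u) = ∫_𝓕 ψ((g u⁻¹)Γ) dν_N(u)` for `n ∈ N`, when the integrand is bounded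
uniformly (co-compact `Γ ∩ N`, continuous `ψ`): the weight form `∫_N β(gm) • ψ((gm)Γ) dν_N(m)` of ★ F2a `integral_toReal_smul_eq_setIntegral` is manifestly invariant.
[cite: MoeglinWaldspurger1995, I.2.6] -/
theorem setIntegral_constantTerm_mul_coe_eq {ψ : G ⧸ Γ → ℂ} (hψ : Continuous ψ) {C : Set N} (hC : IsCompact C)
    (hcov : ∀ u : N, ∃ δ : Γ.subgroupOf N, δ • u ∈ C) {𝓕 : Set N} (h𝓕 : IsFundamentalDomain (Γ.subgroupOf N) 𝓕 νN) [IsFiniteMeasureOnCompacts νN]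
    (g : G) (n : N) :
    ∫ u in 𝓕, ψ (QuotientGroup.mk (g * n * (u : G)⁻¹)) ∂νN = ∫ u in 𝓕, ψ (QuotientGroup.mk (g * (u : G)⁻¹)) ∂νN := by
  obtain ⟨β, hβm, hβ⟩ := exists_weight Γ N
  have hmk : Measurable (QuotientGroup.mk : G → G ⧸ Γ) := QuotientGroup.continuous_mk.measurable
  have hψm : Measurable ψ := hψ.measurable
  have hψ' : ∀ (x : G) (γ : Γ), ψ (QuotientGroup.mk (x * γ)) = ψ (QuotientGroup.mk x) := fun x γ => by rw [QuotientGroup.mk_mul_of_mem x γ.2]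
  have hβtop : ∀ y : G, β y ≠ ∞ := fun y => by
    have h := (ENNReal.le_tsum (1 : N.subgroupOf Γ)).trans (hβ y).le
    simp only [OneMemClass.coe_one, mul_one] at h
    exact ne_top_of_le_ne_top ENNReal.one_ne_top h
  have hfin : νN 𝓕 < ∞ := (measure_le_of_isFundamentalDomain Γ N νN hcov h𝓕).trans_lt hC.measure_lt_top
  -- integrability of the weight form at any base point
  have hint : ∀ x : G, Integrable (fun m : N => (β (x * m)).toReal • ψ (QuotientGroup.mk (x * (m : G)))) νN := fun x => by
    obtain ⟨M, hM0, hM⟩ := exists_bound_norm_apply_mk Γ N hψ hC hcov isCompact_singleton (K₀ := {x})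
    refine ⟨((hβm.comp (measurable_const.mul measurable_subtype_coe)).ennreal_toReal.smul
      ((hψm.comp hmk).comp (measurable_const.mul measurable_subtype_coe))).aestronglyMeasurable, ?_⟩
    rw [HasFiniteIntegral]
    have h1 : ∀ m : N, ‖(β (x * m)).toReal • ψ (QuotientGroup.mk (x * (m : G)))‖ₑ = ‖ψ (QuotientGroup.mk (x * (m : G)))‖ₑ * β (x * m) := fun m => by
      rw [enorm_smul, Real.enorm_eq_ofReal ENNReal.toReal_nonneg, ENNReal.ofReal_toReal (hβtop _), mul_comm]
    simp_rw [h1]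
    have hψn : ∀ (y : G) (γ : Γ), ‖ψ (QuotientGroup.mk (y * γ))‖ₑ = ‖ψ (QuotientGroup.mk y)‖ₑ := fun y γ => by rw [hψ']
    rw [lintegral_mul_weight_eq_setLIntegral Γ N νN (Ψ := fun y => ‖ψ (QuotientGroup.mk y)‖ₑ) (hψm.comp hmk).enorm hβm hψn hβ h𝓕 x]
    calc ∫⁻ u in 𝓕, ‖ψ (QuotientGroup.mk (x * (u : G)⁻¹))‖ₑ ∂νN ≤ ∫⁻ _ in 𝓕, ENNReal.ofReal M ∂νN := by
          refine lintegral_mono fun u => ?_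
          rw [← ofReal_norm]
          exact ENNReal.ofReal_le_ofReal (hM x rfl u)
      _ < ∞ := by
          rw [setLIntegral_const]
          exact ENNReal.mul_lt_top ENNReal.ofReal_lt_top hfin
  rw [← integral_toReal_smul_eq_setIntegral Γ N νN (ψ' := fun x => ψ (QuotientGroup.mk x)) (hψm.comp hmk) hψ' hβm hβ h𝓕 (g * n) (hint (g * n)),
    ← integral_toReal_smul_eq_setIntegral Γ N νN (ψ' := fun x => ψ (QuotientGroup.mk x)) (hψm.comp hmk) hψ' hβm hβ h𝓕 g (hint g),
    ← integral_mul_left_eq_self (fun m : N => (β (g * m)).toReal • ψ (QuotientGroup.mk (g * (m : G)))) n]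
  simp only [Subgroup.coe_mul, mul_assoc]

end Invariance

/-! ## §2 The criterion: `⟨θ_Φ, ψ⟩ = 0` for all `Φ` ⟹ `CT_𝓕 ψ ≡ 0` -/

section Criterion

variable {G : Type*} [Group G] [TopologicalSpace G] [IsTopologicalGroup G] [LocallyCompactSpace G] [SecondCountableTopology G] [T2Space G]
  [MeasurableSpace G] [BorelSpace G] (Γ N : Subgroup G) [DiscreteTopology Γ] [hN : IsClosed (N : Set G)]
  [MeasurableSpace (G ⧸ Γ)] [BorelSpace (G ⧸ Γ)] [MeasurableSpace (G ⧸ N)] [BorelSpace (G ⧸ N)]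
  (μ : Measure (G ⧸ Γ)) [SMulInvariantMeasure G (G ⧸ Γ) μ] [IsFiniteMeasureOnCompacts μ]
  (μN : Measure (G ⧸ N)) [SMulInvariantMeasure G (G ⧸ N) μN] [IsFiniteMeasureOnCompacts μN] [μN.IsOpenPosMeasure]
  (ν : Measure G) [IsHaarMeasure ν] (νN : Measure N) [IsHaarMeasure νN] [SFinite νN] [νN.IsInvInvariant]

include μN ν in
/-- **THE CUSPIDALITY CRITERION ALONG `N`** («`ψ ⊥ θ_φ` for all `φ` ⟹ `ψ_P = 0`», continuous `ψ`).  Let `Γ ≤ G` be discrete, `N ≤ G` closed unimodular with `Γ ∩ N`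
CO-COMPACT in `N`, `μ ≠ 0` invariant on `G ⧸ Γ`, `μ_N` invariant on `G ⧸ N` and POSITIVE ON NON-EMPTY OPEN SETS, `ν`, `ν_N` Haar measures.  If `ψ : G ⧸ Γ → ℂ` is
CONTINUOUS and `∫_{G⧸Γ} θ_Φ · conj ψ dμ = 0` for every Borel right-`N`-invariant `Φ : G → ℂ` with `∫⁻_{G⧸Γ} θ_{‖Φ‖}‖ψ‖ dμ < ∞`, then for EVERY measurable fundamental
domain `𝓕` of `Γ ∩ N` and every `g ∈ G`: `∫_𝓕 ψ((g u⁻¹)Γ) dν_N(u) = 0`. [cite: MoeglinWaldspurger1995, II.1.3] [cite: Garrett2018, §1.8] -/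
theorem setIntegral_constantTerm_eq_zero_of_forall_pseudoEisenstein (hμ : μ ≠ 0) {ψ : G ⧸ Γ → ℂ} (hψ : Continuous ψ)
    {C : Set N} (hC : IsCompact C) (hcov : ∀ u : N, ∃ δ : Γ.subgroupOf N, δ • u ∈ C)
    (horth : ∀ Φ : G → ℂ, Measurable Φ → (∀ (g : G) (n : N), Φ (g * n) = Φ g) →
      ∫⁻ x, (∑' q : Γ ⧸ N.subgroupOf Γ, ‖Φ (x.out * (q.out : G))‖ₑ) * ‖ψ x‖ₑ ∂μ < ∞ →
        ∫ x, (∑' q : Γ ⧸ N.subgroupOf Γ, Φ (x.out * (q.out : G))) * conj (ψ x) ∂μ = 0)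
    {𝓕 : Set N} (h𝓕 : IsFundamentalDomain (Γ.subgroupOf N) 𝓕 νN) (g : G) :
    ∫ u in 𝓕, ψ (QuotientGroup.mk (g * (u : G)⁻¹)) ∂νN = 0 := by
  haveI : IsClosed (Γ : Set G) := Subgroup.isClosed_of_discrete
  have hmkΓ : Measurable (QuotientGroup.mk : G → G ⧸ Γ) := QuotientGroup.continuous_mk.measurable
  have hmkN : Measurable (QuotientGroup.mk : G → G ⧸ N) := QuotientGroup.continuous_mk.measurable
  have hψm : Measurable ψ := hψ.measurable
  have hψc' : Continuous fun x : G ⧸ Γ => conj (ψ x) := Complex.continuous_conj.comp hψ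
  have hfin𝓕 : νN 𝓕 < ∞ := (measure_le_of_isFundamentalDomain Γ N νN hcov h𝓕).trans_lt hC.measure_lt_top
  have hμN0 : μN ≠ 0 := fun h0 => by
    have hpos := isOpen_univ.measure_pos μN ⟨(QuotientGroup.mk 1 : G ⧸ N), trivial⟩
    rw [h0] at hpos
    exact lt_irrefl _ hpos
  -- the constant term of `conj ψ`: continuous on `G`, right-`N`-invariant, hence a continuous function `h̄` on `G ⧸ N`
  obtain ⟨h, hh⟩ : ∃ h : G → ℂ, ∀ x, h x = ∫ u in 𝓕, conj (ψ (QuotientGroup.mk (x * (u : G)⁻¹))) ∂νN := ⟨_, fun _ => rfl⟩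
  have hhdef : h = fun x => ∫ u in 𝓕, conj (ψ (QuotientGroup.mk (x * (u : G)⁻¹))) ∂νN := funext hh
  have hhc : Continuous h := by
    rw [hhdef]
    exact continuous_constantTerm Γ N νN hψc' hC hcov h𝓕
  have hhN : ∀ (x : G) (n : N), h (x * n) = h x := fun x n => by
    rw [hh, hh]
    exact setIntegral_constantTerm_mul_coe_eq Γ N νN hψc' hC hcov h𝓕 x n
  obtain ⟨hb, hhb⟩ : ∃ hb : G ⧸ N → ℂ, ∀ y, hb y = h y.out := ⟨_, fun _ => rfl⟩
  have hcomp : hb ∘ (QuotientGroup.mk : G → G ⧸ N) = h := by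
    funext x
    obtain ⟨n, hn⟩ := QuotientGroup.mk_out_eq_mul N x
    rw [Function.comp_apply, hhb, hn, hhN]
  have hbc : Continuous hb := by
    rw [← QuotientGroup.isOpenQuotientMap_mk.continuous_comp_iff, hcomp]
    exact hhc
  have hbm : Measurable hb := hbc.measurable
  -- it suffices to show `hb = 0` everywhere
  suffices hzero : ∀ y : G ⧸ N, hb y = 0 by
    have h1 : h g = 0 := by rw [← hcomp, Function.comp_apply, hzero]
    rw [hh, integral_conj] at h1
    exact (map_eq_zero_iff _ (RingHom.injective _)).1 h1
  -- bounds on `π_N(K₀)` for a compact `K₀`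
  have hbound : ∀ {K₀ : Set G}, IsCompact K₀ → ∃ M : ℝ, 0 ≤ M ∧ (∀ y ∈ QuotientGroup.mk '' K₀, ‖hb y‖ ≤ M * (νN 𝓕).toReal) ∧
      ∀ y ∈ QuotientGroup.mk '' K₀, ∫⁻ u in 𝓕, ‖ψ (QuotientGroup.mk ((y : G ⧸ N).out * (u : G)⁻¹))‖ₑ ∂νN ≤ ENNReal.ofReal M * νN 𝓕 := by
    intro K₀ hK₀
    obtain ⟨M, hM0, hM⟩ := exists_bound_norm_apply_mk Γ N hψ hC hcov hK₀
    refine ⟨M, hM0, fun y hy => ?_, fun y hy => ?_⟩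
    · obtain ⟨k, hk, rfl⟩ := hy
      obtain ⟨n, hn⟩ := QuotientGroup.mk_out_eq_mul N k
      rw [hhb, hn, hhN, hh]
      calc ‖∫ u in 𝓕, conj (ψ (QuotientGroup.mk (k * (u : G)⁻¹))) ∂νN‖
          ≤ M * νN.real 𝓕 := by
            refine norm_setIntegral_le_of_norm_le_const hfin𝓕 fun u _ => ?_
            rw [Complex.norm_conj]
            exact hM k hk u
        _ = M * (νN 𝓕).toReal := by rw [measureReal_def]
    · obtain ⟨k, hk, rfl⟩ := hy
      obtain ⟨n, hn⟩ := QuotientGroup.mk_out_eq_mul N k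
      rw [hn, setLIntegral_constantTerm_mul_coe_eq Γ N νN (Ψ := fun x => ‖ψ x‖ₑ) hψm.enorm h𝓕 k n]
      calc ∫⁻ u in 𝓕, ‖ψ (QuotientGroup.mk (k * (u : G)⁻¹))‖ₑ ∂νN ≤ ∫⁻ _ in 𝓕, ENNReal.ofReal M ∂νN := by
            refine lintegral_mono fun u => ?_
            rw [← ofReal_norm]
            exact ENNReal.ofReal_le_ofReal (hM k hk u)
        _ = ENNReal.ofReal M * νN 𝓕 := setLIntegral_const _ _
  -- `∫_S hb dμ_N = 0` for Borel `S ⊆ π_N(K₀)`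
  have hvanish : ∀ {K₀ : Set G}, IsCompact K₀ → ∀ S : Set (G ⧸ N), MeasurableSet S → S ⊆ QuotientGroup.mk '' K₀ → ∫ y in S, hb y ∂μN = 0 := by
    intro K₀ hK₀ S hS hSK
    obtain ⟨M, hM0, -, hMl⟩ := hbound hK₀
    have hSfin : μN S < ∞ := (measure_mono hSK).trans_lt (hK₀.image QuotientGroup.continuous_mk).measure_lt_top
    -- the test function `Φ = 𝟙_S ∘ π_N`
    obtain ⟨Φ, hΦ⟩ : ∃ Φ : G → ℂ, ∀ x, Φ x = S.indicator (fun _ => (1 : ℂ)) (QuotientGroup.mk x) := ⟨_, fun _ => rfl⟩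
    have hΦdef : Φ = fun x => S.indicator (fun _ => (1 : ℂ)) (QuotientGroup.mk x) := funext hΦ
    have hΦm : Measurable Φ := by
      rw [hΦdef]
      exact (measurable_const.indicator hS).comp hmkN
    have hΦN : ∀ (x : G) (n : N), Φ (x * n) = Φ x := fun x n => by rw [hΦ, hΦ, QuotientGroup.mk_mul_of_mem x n.2]
    have hΦnorm : ∀ x : G, ‖Φ x‖ₑ = S.indicator (fun _ => (1 : ℝ≥0∞)) (QuotientGroup.mk x) := fun x => by
      rw [hΦ]
      by_cases hx : (QuotientGroup.mk x : G ⧸ N) ∈ S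
      · rw [Set.indicator_of_mem hx, Set.indicator_of_mem hx, enorm_one]
      · rw [Set.indicator_of_notMem hx, Set.indicator_of_notMem hx, enorm_zero]
    -- finiteness of the pairing, by ★ F1 and the bound on `π_N(K₀)`
    have hfinΦ : ∫⁻ x, (∑' q : Γ ⧸ N.subgroupOf Γ, ‖Φ (x.out * (q.out : G))‖ₑ) * ‖ψ x‖ₑ ∂μ < ∞ := by
      have hpos := unfoldingConstant_pos_of_ne_zero Γ N μ μN ν νN hμ hμN0
      have h1 := lintegral_pseudoEisenstein_mul_eq Γ N μ μN ν νN (Φ := fun x => ‖Φ x‖ₑ) hΦm.enorm (fun x n => by rw [hΦN]) hψm.enorm h𝓕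
      have h2 : ∫⁻ y, ‖Φ y.out‖ₑ * ∫⁻ u in 𝓕, ‖ψ (QuotientGroup.mk (y.out * (u : G)⁻¹))‖ₑ ∂νN ∂μN ≤ ENNReal.ofReal M * νN 𝓕 * μN S := by
        calc ∫⁻ y, ‖Φ y.out‖ₑ * ∫⁻ u in 𝓕, ‖ψ (QuotientGroup.mk (y.out * (u : G)⁻¹))‖ₑ ∂νN ∂μN
            ≤ ∫⁻ y, S.indicator (fun _ => ENNReal.ofReal M * νN 𝓕) y ∂μN := by
              refine lintegral_mono fun y => ?_
              rw [hΦnorm, QuotientGroup.out_eq']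
              by_cases hy : y ∈ S
              · rw [Set.indicator_of_mem hy, Set.indicator_of_mem hy, one_mul]
                exact hMl y (hSK hy)
              · rw [Set.indicator_of_notMem hy, Set.indicator_of_notMem hy, zero_mul]
          _ = ENNReal.ofReal M * νN 𝓕 * μN S := by rw [lintegral_indicator_const hS]
      have h3 : (unfoldingConstant N νN μN ν : ℝ≥0∞) * ∫⁻ x, (∑' q : Γ ⧸ N.subgroupOf Γ, ‖Φ (x.out * (q.out : G))‖ₑ) * ‖ψ x‖ₑ ∂μ < ∞ := by
        rw [h1]
        exact ENNReal.mul_lt_top ENNReal.coe_lt_top (h2.trans_lt (ENNReal.mul_lt_top (ENNReal.mul_lt_top ENNReal.ofReal_lt_top hfin𝓕) hSfin))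
      exact lt_top_iff_ne_top.2 fun htop => (lt_top_iff_ne_top.1 h3) (by rw [htop, ENNReal.mul_top (by exact_mod_cast hpos.2.ne')])
    -- orthogonality + the adjunction for `conj ψ`
    have h0 := horth Φ hΦm hΦN hfinΦ
    have hfin' : ∫⁻ x, (∑' q : Γ ⧸ N.subgroupOf Γ, ‖Φ (x.out * (q.out : G))‖ₑ) * ‖conj (ψ x)‖ₑ ∂μ < ∞ := by
      refine lt_of_le_of_lt (le_of_eq (lintegral_congr fun x => ?_)) hfinΦ
      rw [← ofReal_norm (conj (ψ x)), Complex.norm_conj, ofReal_norm]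
    obtain ⟨-, hadj⟩ := integrable_and_integral_pseudoEisenstein_mul_eq Γ N μ μN ν νN hΦm hΦN hψc'.measurable h𝓕 hμ hfin'
    rw [h0, mul_zero] at hadj
    have hc : ((unfoldingConstant Γ count μ ν : ℝ) : ℂ) ≠ 0 := by
      exact_mod_cast (unfoldingConstant_pos_of_ne_zero Γ N μ μN ν νN hμ hμN0).1.ne'
    have h4 : ∫ y, Φ y.out * ∫ u in 𝓕, conj (ψ (QuotientGroup.mk (y.out * (u : G)⁻¹))) ∂νN ∂μN = 0 :=
      (mul_eq_zero.1 hadj.symm).resolve_left hc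
    rw [← h4, ← integral_indicator hS]
    refine integral_congr_ae (Eventually.of_forall fun y => ?_)
    change S.indicator hb y = Φ y.out * ∫ u in 𝓕, conj (ψ (QuotientGroup.mk (y.out * (u : G)⁻¹))) ∂νN
    rw [hΦ, QuotientGroup.out_eq', ← hh, ← hhb]
    by_cases hy : y ∈ S
    · rw [Set.indicator_of_mem hy, Set.indicator_of_mem hy, one_mul]
    · rw [Set.indicator_of_notMem hy, Set.indicator_of_notMem hy, zero_mul]
  -- `hb = 0` a.e. on `π_N(K₀)`, hence at every point (continuity, `μ_N` charges open sets)
  intro y₀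
  by_contra hy₀
  obtain ⟨K₀, hK₀, hK₀g⟩ := exists_compact_mem_nhds (y₀.out : G)
  obtain ⟨M, hM0, hMb, -⟩ := hbound hK₀
  have hKm : MeasurableSet (QuotientGroup.mk '' K₀ : Set (G ⧸ N)) := (hK₀.image QuotientGroup.continuous_mk).isClosed.measurableSet
  have hKfin : μN (QuotientGroup.mk '' K₀) < ∞ := (hK₀.image QuotientGroup.continuous_mk).measure_lt_top
  have hint : Integrable hb (μN.restrict (QuotientGroup.mk '' K₀)) :=
    Measure.integrableOn_of_bounded hKfin.ne hbm.aestronglyMeasurable (M := M * (νN 𝓕).toReal)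
      ((ae_restrict_iff' hKm).2 (Eventually.of_forall fun y hy => hMb y hy))
  have hae : hb =ᵐ[μN.restrict (QuotientGroup.mk '' K₀)] 0 := by
    refine hint.ae_eq_zero_of_forall_setIntegral_eq_zero fun s hs _ => ?_
    rw [Measure.restrict_restrict hs]
    exact hvanish hK₀ (s ∩ QuotientGroup.mk '' K₀) (hs.inter hKm) Set.inter_subset_right
  -- the open set where `hb ≠ 0` inside `π_N(interior K₀)` contains `y₀` and has measure zero: contradiction
  set V : Set (G ⧸ N) := QuotientGroup.mk '' interior K₀ ∩ {y | hb y ≠ 0} with hV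
  have hVopen : IsOpen V := (QuotientGroup.isOpenMap_coe _ isOpen_interior).inter (isOpen_ne_fun hbc continuous_const)
  have hy₀V : y₀ ∈ V := by
    refine ⟨⟨y₀.out, mem_interior_iff_mem_nhds.2 hK₀g, QuotientGroup.out_eq' y₀⟩, hy₀⟩
  have hVpos : 0 < μN V := hVopen.measure_pos μN ⟨y₀, hy₀V⟩
  have h0 : μN ({y | hb y ≠ 0} ∩ QuotientGroup.mk '' K₀) = 0 := by
    rw [← Measure.restrict_apply' hKm]
    have h1 := ae_iff.1 hae
    simpa using h1
  have hsubV : V ⊆ {y | hb y ≠ 0} ∩ QuotientGroup.mk '' K₀ := fun y hy => ⟨hy.2, Set.image_mono interior_subset hy.1⟩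
  have hVzero : μN V = 0 := measure_mono_null hsubV h0
  exact hVpos.ne' hVzero

end Criterion

end Summit.HodgeConjecture.HodgeConjecture.Cruxes.H413.K2E1PseudoEisensteinCuspidalCriterion

end
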